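import Summits.Ventures.GridStability.Lyapunov.StructurePreservingRate
import Summits.Ventures.GridStability.Lyapunov.TreePoincare
import HarnessLib

/-!
# GridStability/Lyapunov/StructurePreservingRateTree — «SP-RATE» leaf-Poincaré pair from a ROOTED SPANNING
# TREE: `Σ Dᵢφᵢ² ≤ (4·D_max·Σᵢ depthᵢ/β)·Q + (2Σ_gen M/ΣD)·K` (g3's tree Poincaré inequality on the leaf)

Cell `gridfusion` (LADDER-GRIDFUSION), seat gridfusion-lyap-1 (g8). The rate rows of MODEL MV-3 (window:
p544339 / p550229; polytope: p561146 «SP-RATE-POLYTOPE») take an abstract leaf-Poincaré pair `(A, B)`; two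
closed forms are in the tree: `A = 4n²·ΣD/β` (walk telescoping) and `A = 4d·ΣD/β` (`d` = a coupling-graph
diameter bound). HERE a third closed form, from g3's tree Poincaré inequality (`Lyapunov/TreePoincare.lean`,
p482110: `Σᵢ vᵢ² ≤ (Σᵢ depthᵢ)·Σ_{j ≠ root} (v_j − v_{parent j})²` for `v_root = 0` along a parent-pointer
spanning tree with exact depths, and `β·T(v) ≤ Σᵢⱼ Cᵢⱼ(vᵢ − vⱼ)²`):
* **`sum_D_sq_le_of_tree`** — on the momentum leaf, for a rooted spanning tree of the coupling graph
  (`β ≤ b_{j, parent j}`) and any bound `Dᵢ ≤ D_max`: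
  `Σ Dᵢφᵢ² ≤ (4·D_max·(Σᵢ depthᵢ)/β)·Q + (2Σ_gen M/ΣD)·K`
  (variance about the D-weighted mean ≤ variance about the root value ≤ `D_max·Σ(φᵢ − φ_root)²`; tree
  Poincaré; mean part by Cauchy–Schwarz on the leaf as in p544339).
For the NE39-SP graph with a centrally rooted BFS tree (`Σ depth = 185`, `Bench/NE39SPPolytopeRateCentral`)
and uniform `Dᵢ = d`: `A = 740·d/β` against the diameter form's `56·49·d/β = 2744·d/β` (×3.7) and the
original `88·49·d/β` (×5.8) — a constant lever for ★ #126 / p552371, no new certificate. THREE COLUMNS: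
mathematics about MODEL MV-3; no sentence here says a grid is stable or well damped. No definition, no named
fact; standard axioms. [folklore]
-/

noncomputable section

open Set Real Finset
open Summit.Ventures.GridStability.Models.StructurePreserving
open Summit.Ventures.GridStability.Models.StructurePreserving.Params
open Summit.Ventures.GridStability.Lyapunov.TreePoincare (sum_sq_le_sumDepth_mul_treeSum
  treeSum_le_laplacianForm)

namespace Summit.Ventures.GridStability.Lyapunov.StructurePreserving

variable {n : ℕ}

/-- **The tree leaf-Poincaré pair.** Well-formed data on `n ≠ 0` buses, susceptive couplings `bᵢⱼ ≥ 0`; a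
rooted spanning structure of the coupling graph given as a parent array with EXACT depths
(`depth root = 0`, `depth (parent i) + 1 = depth i` off the root) whose tree edges carry couplings
`b_{j, parent j} ≥ β > 0`; a bound `Dᵢ ≤ D_max`. On the momentum leaf (`constraintSet`):
`Σ Dᵢφᵢ² ≤ (4·D_max·Σᵢ depthᵢ/β)·Q + (2Σ_gen M/ΣD)·K`, `φ = δ − δ₀`, `Q = ½ΣᵢΣⱼ bᵢⱼ(Δσᵢⱼ)²/2`,
`K = ½Σ_gen Mᵢωᵢ²`. [folklore] -/
theorem sum_D_sq_le_of_tree {p : Params n} (hp : p.WellFormed) (hn : n ≠ 0)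
    (hb : ∀ i j, 0 ≤ p.b i j) {β : ℝ} (hβ : 0 < β)
    (root : Fin n) (parent : Fin n → Fin n) (depth : Fin n → ℕ) (hroot : depth root = 0)
    (hdepth : ∀ i, i ≠ root → depth (parent i) + 1 = depth i)
    (hβb : ∀ j, j ≠ root → β ≤ p.b j (parent j))
    {Dmax : ℝ} (hDmax : ∀ i, p.D i ≤ Dmax)
    {δ₀ : Fin n → ℝ} {x : (Fin n → ℝ) × (Fin n → ℝ)} (hx : x ∈ constraintSet p δ₀) :
    ∑ i, p.D i * (x.1 i - δ₀ i) ^ 2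
      ≤ 4 * Dmax * (∑ i, (depth i : ℝ)) / β
          * ((1 / 2) * ∑ i, ∑ j, p.b i j * (((x.1 i - x.1 j) - (δ₀ i - δ₀ j)) ^ 2 / 2))
        + 2 * (∑ i ∈ p.gen, p.M i) / (∑ i, p.D i) * p.kinetic x.2 := by
  set φ : Fin n → ℝ := fun i => x.1 i - δ₀ i with hφ
  set SD : ℝ := ∑ i, p.D i with hSD
  set Qx : ℝ := (1 / 2) * ∑ i, ∑ j, p.b i j * (((x.1 i - x.1 j) - (δ₀ i - δ₀ j)) ^ 2 / 2)
    with hQx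
  set s : ℝ := ∑ j, p.D j * φ j with hs
  have hSDpos : 0 < SD := sum_D_pos hp hn
  have hQ0 : 0 ≤ Qx := p.quadraticGap_nonneg hb δ₀ x.1
  have hDmax0 : 0 ≤ Dmax := by
    obtain ⟨k, hk⟩ := Nat.exists_eq_succ_of_ne_zero hn
    subst hk
    exact (hp.D_pos 0).le.trans (hDmax 0)
  -- (1) tree Poincaré for `v = φ − φ_root`
  set v : Fin n → ℝ := fun i => φ i - φ root with hv
  have hvroot : v root = 0 := by simp [hv]
  have htree := sum_sq_le_sumDepth_mul_treeSum parent depth root hroot hdepth v hvroot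
  have hlap := treeSum_le_laplacianForm parent root p.b hb hβb v
  -- the Laplacian form of `v` is `4Q`
  have hform : ∑ i, ∑ j, p.b i j * (v i - v j) ^ 2 = 4 * Qx := by
    rw [hQx, ← mul_assoc, show (4 : ℝ) * (1 / 2) = 2 by norm_num, Finset.mul_sum]
    refine Finset.sum_congr rfl fun i _ => ?_
    rw [Finset.mul_sum]
    refine Finset.sum_congr rfl fun j _ => ?_
    simp only [hv, hφ]
    ring
  have hT : ∑ j ∈ univ.erase root, (v j - v (parent j)) ^ 2 ≤ 4 * Qx / β := by
    rw [le_div_iff₀ hβ, mul_comm]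
    rw [hform] at hlap
    exact hlap
  have hsumsq : ∑ i, v i ^ 2 ≤ (∑ i, (depth i : ℝ)) * (4 * Qx / β) :=
    htree.trans (mul_le_mul_of_nonneg_left hT (Finset.sum_nonneg fun i _ => Nat.cast_nonneg _))
  -- (2) variance about the D-weighted mean ≤ D-weighted variance about the root value ≤ D_max·Σ v²
  have hvar : ∑ i, p.D i * φ i ^ 2 = ∑ i, p.D i * (φ i - s / SD) ^ 2 + s ^ 2 / SD := by
    have hexp : ∑ i, p.D i * (φ i - s / SD) ^ 2
        = ∑ i, p.D i * φ i ^ 2 - 2 * (s / SD) * ∑ i, p.D i * φ i + (s / SD) ^ 2 * ∑ i, p.D i := by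
      rw [Finset.mul_sum, Finset.mul_sum, ← Finset.sum_sub_distrib, ← Finset.sum_add_distrib]
      exact Finset.sum_congr rfl fun i _ => by ring
    rw [hexp, ← hs, ← hSD]
    field_simp
    ring
  have hshift : ∑ i, p.D i * (φ i - s / SD) ^ 2 ≤ ∑ i, p.D i * v i ^ 2 := by
    -- `Σ D(φ − a)² = Σ D(φ − m)² + SD·(m − a)²` with `m = s/SD`, here `a = φ root`
    have hexp : ∑ i, p.D i * v i ^ 2
        = ∑ i, p.D i * (φ i - s / SD) ^ 2 + 2 * (s / SD - φ root) * ∑ i, p.D i * (φ i - s / SD)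
          + (s / SD - φ root) ^ 2 * ∑ i, p.D i := by
      rw [Finset.mul_sum, Finset.mul_sum, ← Finset.sum_add_distrib, ← Finset.sum_add_distrib]
      exact Finset.sum_congr rfl fun i _ => by simp only [hv]; ring
    have hzero : ∑ i, p.D i * (φ i - s / SD) = 0 := by
      have : ∑ i, p.D i * (φ i - s / SD) = ∑ i, p.D i * φ i - (s / SD) * ∑ i, p.D i := by
        rw [Finset.mul_sum, ← Finset.sum_sub_distrib]
        exact Finset.sum_congr rfl fun i _ => by ring
      rw [this, ← hs, ← hSD]
      field_simp
      ring
    rw [hexp, hzero, mul_zero, add_zero, ← hSD]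
    nlinarith [sq_nonneg (s / SD - φ root)]
  have hDv : ∑ i, p.D i * v i ^ 2 ≤ Dmax * ∑ i, v i ^ 2 := by
    rw [Finset.mul_sum]
    exact Finset.sum_le_sum fun i _ => mul_le_mul_of_nonneg_right (hDmax i) (sq_nonneg _)
  have hvarbd : ∑ i, p.D i * (φ i - s / SD) ^ 2 ≤ Dmax * ((∑ i, (depth i : ℝ)) * (4 * Qx / β)) :=
    hshift.trans (hDv.trans (mul_le_mul_of_nonneg_left hsumsq hDmax0))
  -- (3) the mean part: the leaf pins `s = −Σ_gen Mω`, Cauchy–Schwarz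
  have hmom : s = -∑ j ∈ p.gen, p.M j * x.2 j := by
    have hL := hx.1
    unfold Params.momentum at hL
    simp only [Pi.zero_apply, mul_zero, Finset.sum_const_zero, zero_add] at hL
    have hsplit : ∑ j, p.D j * x.1 j - ∑ j, p.D j * δ₀ j = s := by
      rw [hs, ← Finset.sum_sub_distrib]
      exact Finset.sum_congr rfl fun j _ => by simp only [hφ]; ring
    linarith
  have hCS : s ^ 2 ≤ (∑ j ∈ p.gen, p.M j) * (2 * p.kinetic x.2) := by
    rw [hmom, neg_sq]
    have h := Finset.sum_sq_le_sum_mul_sum_of_sq_le_mul p.gen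
      (r := fun j => p.M j * x.2 j) (f := fun j => p.M j) (g := fun j => p.M j * x.2 j ^ 2)
      (fun j hj => (hp.M_pos j hj).le)
      (fun j hj => mul_nonneg (hp.M_pos j hj).le (sq_nonneg _))
      (fun j _ => by ring_nf; exact le_rfl)
    have hK : 2 * p.kinetic x.2 = ∑ j ∈ p.gen, p.M j * x.2 j ^ 2 := by
      unfold Params.kinetic; ring
    rw [hK]
    exact h
  have hmean : s ^ 2 / SD ≤ 2 * (∑ i ∈ p.gen, p.M i) / SD * p.kinetic x.2 := by
    rw [div_le_iff₀ hSDpos]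
    have : 2 * (∑ i ∈ p.gen, p.M i) / SD * p.kinetic x.2 * SD
        = (∑ j ∈ p.gen, p.M j) * (2 * p.kinetic x.2) := by
      field_simp
    rw [this]
    exact hCS
  -- (4) assemble
  have hmain : ∑ i, p.D i * φ i ^ 2
      ≤ Dmax * ((∑ i, (depth i : ℝ)) * (4 * Qx / β)) + 2 * (∑ i ∈ p.gen, p.M i) / SD * p.kinetic x.2 := by
    rw [hvar]
    exact add_le_add hvarbd hmean
  have hrew : Dmax * ((∑ i, (depth i : ℝ)) * (4 * Qx / β))
      = 4 * Dmax * (∑ i, (depth i : ℝ)) / β * Qx := by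
    field_simp
  rw [hrew] at hmain
  simpa only [hφ, hSD, hQx] using hmain

end Summit.Ventures.GridStability.Lyapunov.StructurePreserving

end
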